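import Summits.NavierStokesRegularity.NavierStokesRegularity.Theorems.IntenseSetDoorsAssemblyTools
import Literature.Analysis.FluidPDE.LerayLocalRegularH1Proofs
import Literature.Analysis.FluidPDE.VorticityFormulationHolds
import HarnessLib

/-!
# ArgmaxDoorsFrame — door family S35 «ArgmaxDoors», frame tools on closed slabs

In the S-door frame on a closed slab `[0,T''] × ℝ³` (classical unforced Navier–Stokes solution, all `L²`
Sobolev seminorms bounded):

* `norm_timeDerivWithin_vorticity_le` — `‖∂ₜω‖ ≤ L` pointwise (`∂ₜω = νΔω − (u·∇)ω + (ω·∇)u` against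
  the class sup bounds of `u, Du, D²u, D³u`), so `ω` is Lipschitz in time uniformly in space;
* `vorticity_uniform_decay` — `|ω(t,x)| → 0` as `|x| → ∞` UNIFORMLY in `t ∈ [0,T'']` (finite `δ`-net of
  times, per-slice decay `tendsto_curl_cocompact`, time-Lipschitz bound): the compactness input of the
  sup-norm comparison `ArgmaxDoorsSupNorm`.

HONEST FRAME / WHAT THIS IS NOT: tools for regularity CRITERIA about hypothetical blow-up (door family S35
«ArgmaxDoors», nsreg-p1 g29 ROUND-33, S-door lane LEAD ns-s30-p1 g3, `--supports stmt-NavierStokesRegularity-0056 --as helper`);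
item 0056 `NoTypeII` and NS regularity are NOT proved; no Literature fact is taken as a hypothesis; nothing here is a
route or a summit statement.
-/

noncomputable section

set_option linter.dupNamespace false

open MeasureTheory Set Function Filter Metric Real InnerProductSpace
open _root_.Topology
open scoped ENNReal NNReal RealInnerProductSpace ContDiff Laplacian
open Literature.Analysis Literature.Analysis.FluidPDE

namespace Summit.NavierStokesRegularity.NavierStokesRegularity.Theorems.ArgmaxDoors

section Frame

-- nested operator types (second and third derivatives)
set_option maxSynthPendingDepth 3

/-- **Pointwise bound of `∂ₜω` on a closed slab.** For a classical unforced Navier–Stokes solution on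
`[0,T''] × ℝ³` with all `L²` Sobolev seminorms bounded there is `L ≥ 0` with
`‖∂ₜω(t,x)‖ ≤ L` for all `t ∈ [0,T'']`, `x` (`∂ₜω = νΔω − (u·∇)ω + (ω·∇)u` and the sup bounds of
`u, Du, D²u, D³u` in the class). [folklore] -/
theorem norm_timeDerivWithin_vorticity_le {ν T'' : ℝ} (hν : 0 < ν) (hT'' : 0 < T'')
    {u : ℝ → (EuclideanSpace ℝ (Fin 3)) → (EuclideanSpace ℝ (Fin 3))}
    {p : ℝ → (EuclideanSpace ℝ (Fin 3)) → ℝ} (hS : IsClassicalNSSolutionOn (Icc 0 T'') ν 0 u p)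
    (hB : HasBoundedSobolevNormsOn (Icc 0 T'') u) :
    ∃ L : ℝ, 0 ≤ L ∧ ∀ t ∈ Icc 0 T'', ∀ x,
      ‖timeDerivWithin (Icc 0 T'') (vorticity u) t x‖ ≤ L := by
  have hU : UniqueDiffOn ℝ (Icc 0 T'') := uniqueDiffOn_Icc hT''
  have hsm : ∀ t ∈ Icc 0 T'', ContDiff ℝ ∞ (u t) := fun t ht => hS.contDiff_velocity ht
  set κ : ℝ := ‖curlCLM‖ with hκ
  obtain ⟨C0, hC0⟩ := exists_forall_norm_iteratedFDeriv_le_of_hasBoundedSobolevNormsOn hsm hB 0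
  obtain ⟨C1, hC1⟩ := exists_forall_norm_iteratedFDeriv_le_of_hasBoundedSobolevNormsOn hsm hB 1
  obtain ⟨C2, hC2⟩ := exists_forall_norm_iteratedFDeriv_le_of_hasBoundedSobolevNormsOn hsm hB 2
  obtain ⟨C3, hC3⟩ := exists_forall_norm_iteratedFDeriv_le_of_hasBoundedSobolevNormsOn hsm hB 3
  have h0 : (0 : ℝ) ∈ Icc 0 T'' := ⟨le_rfl, hT''.le⟩
  have hC00 : 0 ≤ C0 := (norm_nonneg _).trans (hC0 0 h0 0)
  have hC10 : 0 ≤ C1 := (norm_nonneg _).trans (hC1 0 h0 0)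
  have hC20 : 0 ≤ C2 := (norm_nonneg _).trans (hC2 0 h0 0)
  have hC30 : 0 ≤ C3 := (norm_nonneg _).trans (hC3 0 h0 0)
  have hvort : ∀ t ∈ Icc 0 T'', ∀ x,
      timeDerivWithin (Icc 0 T'') (vorticity u) t x + convect (u t) (vorticity u t) x =
        convect (vorticity u t) (u t) x + ν • (Δ (vorticity u t)) x :=
    fun t ht x =>
    (hS.isVorticitySolutionOn_of_uniqueDiffOn hU (fun s _ y => curl_zero y)).vorticity_eq t ht x
  refine ⟨ν * (3 * κ) * C3 + C0 * κ * C2 + C1 * κ * C1, by positivity, fun t ht x => ?_⟩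
  have hv : ContDiff ℝ 3 (u t) := (hsm t ht).of_le (by norm_cast)
  have hw2 : ContDiff ℝ 2 (curl (u t)) := contDiff_curl (n := 2) (by exact hv)
  have hωt : vorticity u t = curl (u t) := rfl
  set w := timeDerivWithin (Icc 0 T'') (vorticity u) t x with hw
  have heq : w = ν • (Δ (curl (u t))) x - convect (u t) (curl (u t)) x +
      convect (curl (u t)) (u t) x := by
    have h := hvort t ht x
    rw [hωt] at h
    have : w = convect (curl (u t)) (u t) x + ν • (Δ (curl (u t))) x - convect (u t) (curl (u t)) x :=
      eq_sub_of_add_eq h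
    rw [this]; abel
  rw [heq]
  have t1 : ‖ν • (Δ (curl (u t))) x‖ ≤ (ν * (3 * κ)) * C3 := by
    rw [norm_smul, Real.norm_of_nonneg hν.le, mul_assoc]
    refine mul_le_mul_of_nonneg_left ?_ hν.le
    calc ‖(Δ (curl (u t))) x‖ ≤ 3 * ‖iteratedFDeriv ℝ 2 (curl (u t)) x‖ :=
          norm_laplacian_le_three_mul_norm_iteratedFDeriv_two hw2 x
      _ ≤ 3 * (κ * ‖iteratedFDeriv ℝ 3 (u t) x‖) :=
          mul_le_mul_of_nonneg_left
            (norm_iteratedFDeriv_curl_le_opNorm_mul hv 2 (by norm_num) x) (by norm_num)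
      _ ≤ 3 * (κ * C3) := by gcongr; exact hC3 t ht x
      _ = 3 * κ * C3 := by ring
  have t2 : ‖convect (u t) (curl (u t)) x‖ ≤ C0 * κ * C2 := by
    rw [convect]
    calc ‖fderiv ℝ (curl (u t)) x (u t x)‖ ≤ ‖fderiv ℝ (curl (u t)) x‖ * ‖u t x‖ :=
          ContinuousLinearMap.le_opNorm _ _
      _ ≤ (κ * ‖iteratedFDeriv ℝ 2 (u t) x‖) * C0 := by
          refine mul_le_mul ?_ ?_ (norm_nonneg _) (by positivity)
          · rw [← norm_iteratedFDeriv_one]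
            exact norm_iteratedFDeriv_curl_le_opNorm_mul hv 1 (by norm_num) x
          · have h := hC0 t ht x
            rwa [norm_iteratedFDeriv_zero] at h
      _ ≤ (κ * C2) * C0 := by gcongr; exact hC2 t ht x
      _ = C0 * κ * C2 := by ring
  have t3 : ‖convect (curl (u t)) (u t) x‖ ≤ C1 * κ * C1 := by
    rw [convect]
    calc ‖fderiv ℝ (u t) x (curl (u t) x)‖ ≤ ‖fderiv ℝ (u t) x‖ * ‖curl (u t) x‖ :=
          ContinuousLinearMap.le_opNorm _ _
      _ ≤ C1 * (κ * ‖iteratedFDeriv ℝ 1 (u t) x‖) := by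
          refine mul_le_mul ?_ ?_ (norm_nonneg _) hC10
          · have h := hC1 t ht x
            rwa [norm_iteratedFDeriv_one] at h
          · have h := norm_iteratedFDeriv_curl_le_opNorm_mul hv 0 (by norm_num) x
            rwa [norm_iteratedFDeriv_zero] at h
      _ ≤ C1 * (κ * C1) := by gcongr; exact hC1 t ht x
      _ = C1 * κ * C1 := by ring
  have e1 : ‖ν • (Δ (curl (u t))) x - convect (u t) (curl (u t)) x + convect (curl (u t)) (u t) x‖ ≤
      ‖ν • (Δ (curl (u t))) x - convect (u t) (curl (u t)) x‖ + ‖convect (curl (u t)) (u t) x‖ :=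
    norm_add_le _ _
  have e2 : ‖ν • (Δ (curl (u t))) x - convect (u t) (curl (u t)) x‖ ≤
      ‖ν • (Δ (curl (u t))) x‖ + ‖convect (u t) (curl (u t)) x‖ := norm_sub_le _ _
  linarith [e1, e2, t1, t2, t3]

/-- **Uniform spatial decay of the vorticity on a closed slab.** For a classical unforced
Navier–Stokes solution on `[0,T''] × ℝ³` with all `L²` Sobolev seminorms bounded:
`‖ω(t,x)‖ → 0` as `‖x‖ → ∞` uniformly in `t ∈ [0,T'']` — for every `η > 0` there is `R` with
`‖curl u(t,x)‖ ≤ η` whenever `t ∈ [0,T'']` and `R ≤ ‖x‖`. Proof: `ω` is Lipschitz in time uniformly in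
space (`norm_timeDerivWithin_vorticity_le` + the mean value inequality within `[0,T'']`); each slice
decays (`tendsto_curl_cocompact`); a finite `δ`-net of times. [folklore] -/
theorem vorticity_uniform_decay {ν T'' : ℝ} (hν : 0 < ν) (hT'' : 0 < T'')
    {u : ℝ → (EuclideanSpace ℝ (Fin 3)) → (EuclideanSpace ℝ (Fin 3))}
    {p : ℝ → (EuclideanSpace ℝ (Fin 3)) → ℝ} (hS : IsClassicalNSSolutionOn (Icc 0 T'') ν 0 u p)
    (hB : HasBoundedSobolevNormsOn (Icc 0 T'') u) :
    ∀ η : ℝ, 0 < η → ∃ R : ℝ, ∀ t ∈ Icc 0 T'', ∀ x : EuclideanSpace ℝ (Fin 3),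
      R ≤ ‖x‖ → ‖curl (u t) x‖ ≤ η := by
  intro η hη
  have hU : UniqueDiffOn ℝ (Icc 0 T'') := uniqueDiffOn_Icc hT''
  -- time-Lipschitz bound
  obtain ⟨L, hL0, hL⟩ := norm_timeDerivWithin_vorticity_le hν hT'' hS hB
  have hωsm : IsSmoothSpaceTimeOn (Icc 0 T'') (vorticity u) :=
    (hS.smooth_velocity.fderiv_slice hU).clm_comp curlCLM
  have hlip : ∀ s ∈ Icc 0 T'', ∀ t ∈ Icc 0 T'', ∀ x,
      ‖curl (u t) x - curl (u s) x‖ ≤ L * |t - s| := by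
    intro s hs t ht x
    have hd : ∀ τ ∈ Icc 0 T'', HasDerivWithinAt (fun r => vorticity u r x)
        (timeDerivWithin (Icc 0 T'') (vorticity u) τ x) (Icc 0 T'') τ := fun τ hτ => by
      rw [timeDerivWithin_apply]
      exact (hωsm.differentiableWithinAt_time hτ x).hasDerivWithinAt
    have h := (convex_Icc 0 T'').norm_image_sub_le_of_norm_hasDerivWithin_le hd
      (fun τ hτ => hL τ hτ x) hs ht
    simpa [vorticity, Real.norm_eq_abs] using h
  -- a finite `δ`-net of times
  set δ : ℝ := η / (2 * (L + 1)) with hδ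
  have hδpos : 0 < δ := by positivity
  obtain ⟨net, hnet, hcover⟩ := (isCompact_Icc (a := (0 : ℝ)) (b := T'')).elim_nhds_subcover
    (fun c => Metric.ball c δ) (fun c _ => Metric.ball_mem_nhds c hδpos)
  -- per-slice decay radii
  obtain ⟨B₁, B₂, -, -, hpk⟩ := IntenseSetDoors.slice_package hS hB
  have hslice : ∀ c ∈ Icc 0 T'', ∃ Rc : ℝ, 0 ≤ Rc ∧ ∀ x : EuclideanSpace ℝ (Fin 3),
      Rc ≤ ‖x‖ → ‖curl (u c) x‖ ≤ η / 2 := by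
    intro c hc
    obtain ⟨hv3, -, -, i1, -, -, hB₂⟩ := hpk c hc
    have hv2 : ContDiff ℝ 2 (u c) := hv3.of_le (by norm_cast)
    have hdec := tendsto_curl_cocompact hv2 i1 hB₂
    have hev : ∀ᶠ y in cocompact (EuclideanSpace ℝ (Fin 3)), ‖curl (u c) y‖ < η / 2 := by
      have h := Metric.tendsto_nhds.1 hdec (η / 2) (half_pos hη)
      filter_upwards [h] with y hy
      simpa [dist_zero_right] using hy
    obtain ⟨K, hK, hKs⟩ := mem_cocompact.1 hev
    obtain ⟨Rc, hRc⟩ := hK.isBounded.subset_closedBall 0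
    refine ⟨max Rc 0 + 1, by positivity, fun x hx => ?_⟩
    have hxK : x ∉ K := by
      intro hxK
      have h := hRc hxK
      rw [Metric.mem_closedBall, dist_zero_right] at h
      linarith [le_max_left Rc 0]
    exact (hKs hxK).le
  choose! Rc hRc0 hRc using hslice
  refine ⟨∑ c ∈ net, Rc c, fun t ht x hx => ?_⟩
  -- pick a net point `c` with `|t − c| < δ`
  have htc := hcover ht
  simp only [mem_iUnion, Metric.mem_ball, exists_prop] at htc
  obtain ⟨c, hcnet, htcδ⟩ := htc
  have hc : c ∈ Icc 0 T'' := hnet c hcnet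
  have hRx : Rc c ≤ ‖x‖ :=
    (Finset.single_le_sum (fun c' hc' => hRc0 c' (hnet c' hc')) hcnet).trans hx
  have h1 : ‖curl (u c) x‖ ≤ η / 2 := hRc c hc x hRx
  have h2 : ‖curl (u t) x - curl (u c) x‖ ≤ L * |t - c| := hlip c hc t ht x
  have h3 : L * |t - c| ≤ η / 2 := by
    have hlt : |t - c| < δ := by rwa [← Real.dist_eq]
    calc L * |t - c| ≤ L * δ := mul_le_mul_of_nonneg_left hlt.le hL0
      _ ≤ (L + 1) * δ := mul_le_mul_of_nonneg_right (by linarith) hδpos.le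
      _ = η / 2 := by rw [hδ]; field_simp
  calc ‖curl (u t) x‖ = ‖curl (u c) x + (curl (u t) x - curl (u c) x)‖ := by
        congr 1; abel
    _ ≤ ‖curl (u c) x‖ + ‖curl (u t) x - curl (u c) x‖ := norm_add_le _ _
    _ ≤ η / 2 + η / 2 := add_le_add h1 (h2.trans h3)
    _ = η := by ring


end Frame

end Summit.NavierStokesRegularity.NavierStokesRegularity.Theorems.ArgmaxDoors

end
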